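import Summits.ABC.IUTFork.Cor312PinnedRegions
import Summits.ABC.IUTFork.Cor312ColumnTransport
import Summits.ABC.IUTFork.Cor312QTwist
import HarnessLib

/-!
# [IUTchIII] Cor. 3.12 — the PINNED reading (PR-1) under the C-transports: what moves, what is
pinned, and the ONE cross-column identification its étale coricity consumes

Record-only file (D-0012) of the abc-iut cell (D-0067 Cor. 3.12 strategy TEAM C «étale-picture /
multiradiality», seat abc-iut-c312-13, row C-13 of `HOME/plan/C312-TEAMS.md`); TAKES NO SIDE;
proof-only. PR-1 (director-abc 01:56:18Z; w5-d230 `Cor312PinnedRegions` p417551, w5-d155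
`Cor312PinnedRegionsQSide` p417444, audited SOUND by PR-3 02:26:30Z) pins the two glue fields of the
frozen `Cor312.Setting` to Kummer data through one ⟨(Ind1) ∪ (Ind2)⟩-equivariant region-forming
operator `ρ`: `ThetaPinned` (every `thetaRegion m` = `ρ` of the column's Kummer image `frobΨ m`) and
`QPinned` (`qRegion` = `ρ qK` for the uninterpreted q-side Kummer datum `qK`). THIS file computes the
pinned reading under the re-choices the frozen types leave open (rows C-1/C-3/C-7), continuing the
C-11 analysis one level deeper:

* Θ-GLUE TWIST (§1): the twisted setting is pinned by the SAME `ρ` to the `starAut Φ₀`-TRANSPORTED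
  Kummer data (`thetaPinned_twistGlue_map` — the reading's own equivariance clause (hρ) is exactly
  what makes the pair (glue, Kummer datum) move together); the NAIVE pin to the untransported
  `frobΨ` survives iff the `ρ`-output is `Φ₀`-fixed (`thetaPinned_twistGlue_iff_fixed`, C-11's
  pattern); the q-pin ignores the Θ-twist (`qPinned_twistGlue_iff`).
* (Ind3) RE-INDEX (§2): the PER-`m` pin is the first object in this lane SENSITIVE to the (Ind3)
  `m`-labelling — the re-indexed setting is pinned to the RE-INDEXED Kummer family `frobΨ ∘ e`
  (`thetaPinned_reindexGlue_map`); the `⋃ₘ`-level consequences (`thetaRegion3_eq_of_thetaPinned`'s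
  coric collapse, `GapA″`'s conclusion, the Statement) remain reindex-invariant (rows C-1/C-9).
* ÉTALE COLUMN TRANSPORT (§3) — THE ISOLATION THIS FILE EXISTS FOR: the recolumned setting is
  `PinnedRegions` for the `starAut Φ`-moved q-datum PROVIDED one identification holds —
  **`starAut Φ '' (S.col P.n).frobΨ m = (S.col n').frobΨ m`** (hypothesis `hfrob` of
  `thetaPinned_recolumn_of_frobCompat` / `pinnedRegions_recolumn_of_frobCompat`): the
  identification of copies BETWEEN COLUMNS' KUMMER IMAGES. The q-pin transports covariantly with NO
  condition (`qPinned_recolumn_map`). So the étale coricity of the pinned gap consumes EXACTLY this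
  cross-column Kummer identification (Thm. 3.11 (ii)'s log-Kummer content ACROSS columns, p. 154–156)
  — the row C-2 charter question «which identification of copies does the step use», answered for
  PR-1's reading. Nothing in the frozen vocabulary supplies `hfrob`; stating it as the explicit cost
  is the point, not a defect.
* q-GLUE TWIST (§4): mirrors of §1 for the q-pin (`qPinned_qTwistGlue_map` /
  `qPinned_qTwistGlue_iff_fixed`); the Θ-pin ignores the q-twist (`thetaPinned_qTwistGlue_iff`).

Consumes (read-only): PR-1's predicates, rows C-1 (`twistGlue`/`reindexGlue`), C-3 (`recolumn`),
C-7 (`qTwistGlue`). No new definitions, no `Prop` facts, FACT-LIST untouched; equivariance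
hypotheses are taken in PR-1's own `Subgroup.closure (Ind1Family ∪ Ind2Family)` form. Deliberately
NOT here: any claim that the pins hold or fail for an instantiated setting (PR-2's lane); any
assertion of `hfrob`. Nothing here asserts Cor. 3.12. [claim: Mochizuki2012, status: disputed] for
the quoted clauses; proofs are [folklore] bookkeeping over the pins' own clauses.
-/

noncomputable section

namespace Summit.ABC.IUTFork.Cor312Vol

open Thm311 Cor312 Literature.IUT.LogThetaLattice

variable {T : ThetaIndex} (S : LatticeSituation T) (P : Cor312.Setting S.toSituation)
  (ρ : (∀ v : T.V, v ∈ T.Vbad → Set (S.L.StarPacket v)) →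
    ∀ (j : T.Label) (vQ : T.VQ), Set (S.L.Packet j vQ))
  (qK : ∀ v : T.V, v ∈ T.Vbad → Set (S.L.StarPacket v))

/-! ## 1. The Θ-glue twist: the pin moves WITH the Kummer datum, by the reading's own equivariance -/

section ThetaTwist
variable (Φ₀ : S.toSituation.L.PacketAut)

/-- **The twisted setting is pinned to the TRANSPORTED Kummer data**: the (hρ) clause of
`ThetaPinned` is exactly the statement that the pair (glue, Kummer datum) moves together under the
(Ind1)(Ind2) re-choice. [folklore] -/
theorem thetaPinned_twistGlue_map
    (hΦ₀ : Φ₀ ∈ Subgroup.closure (S.L.Ind1Family ∪ S.L.Ind2Family))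
    (hΘ : ThetaPinned S P ρ) (m : ℤ) (j : T.Label) (vQ : T.VQ) :
    (P.twistGlue Φ₀).thetaRegion m j vQ =
      ρ (fun v hv => S.L.starAut Φ₀ v '' (S.col P.n).frobΨ m v hv) j vQ := by
  rw [P.twistGlue_thetaRegion Φ₀ m j vQ, hΘ.2 m j vQ,
    ← hΘ.1 Φ₀ hΦ₀ ((S.col P.n).frobΨ m) j vQ]

/-- **The NAIVE pin does not survive a bare Θ-glue twist**: given `ThetaPinned` at `P`, the twisted
setting carries the pin to the UNTRANSPORTED `frobΨ` iff the `ρ`-output is fixed by the twist —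
the C-11 pattern (`computedBy_twistGlue_iff_fixed`) at the pinned level. [folklore] -/
theorem thetaPinned_twistGlue_iff_fixed
    (hΦ₀ : Φ₀ ∈ Subgroup.closure (S.L.Ind1Family ∪ S.L.Ind2Family))
    (hΘ : ThetaPinned S P ρ) :
    (∀ (m : ℤ) (j : T.Label) (vQ : T.VQ),
        (P.twistGlue Φ₀).thetaRegion m j vQ = ρ ((S.col P.n).frobΨ m) j vQ) ↔
      ∀ (m : ℤ) (j : T.Label) (vQ : T.VQ),
        ρ (fun v hv => S.L.starAut Φ₀ v '' (S.col P.n).frobΨ m v hv) j vQ =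
          ρ ((S.col P.n).frobΨ m) j vQ := by
  refine forall_congr' fun m => forall_congr' fun j => forall_congr' fun vQ => ?_
  rw [thetaPinned_twistGlue_map S P ρ Φ₀ hΦ₀ hΘ m j vQ]

/-- The q-pin ignores the Θ-glue twist (the q-side never reads the Θ-glue). [folklore] -/
theorem qPinned_twistGlue_iff : QPinned S (P.twistGlue Φ₀) ρ qK ↔ QPinned S P ρ qK :=
  Iff.rfl

end ThetaTwist

/-! ## 2. The (Ind3) re-index: the PER-`m` pin tracks the `m`-labelling -/

section Reindex
variable (e : ℤ ≃ ℤ)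

/-- **The per-`m` pin is (Ind3)-`m`-SENSITIVE** — the first object in this lane that is: the
re-indexed setting is pinned (by the same `ρ`) to the RE-INDEXED Kummer family `m ↦ frobΨ (e m)`.
Everything at the `⋃ₘ` level (the coric collapse `thetaRegion3_eq_of_thetaPinned`, `GapA″`'s
conclusion, the Statement — rows C-1/C-9) remains reindex-invariant; only the labelling of the pin
moves. [folklore] -/
theorem thetaPinned_reindexGlue_map (hΘ : ThetaPinned S P ρ) (m : ℤ) (j : T.Label) (vQ : T.VQ) :
    (P.reindexGlue e).thetaRegion m j vQ = ρ ((S.col P.n).frobΨ (e m)) j vQ := by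
  rw [P.reindexGlue_thetaRegion e m j vQ, hΘ.2 (e m) j vQ]

/-- The q-pin absorbs the (Ind3) re-index (definitional). [folklore] -/
theorem qPinned_reindexGlue_iff : QPinned S (P.reindexGlue e) ρ qK ↔ QPinned S P ρ qK :=
  Iff.rfl

end Reindex

/-! ## 3. The étale column transport: coricity of the pins modulo ONE cross-column identification -/

section Recolumn
variable (n' : ℤ) (Φ : S.toSituation.L.PacketAut)
  (hD : S.toSituation.D n' = (S.toSituation.D P.n).map Φ)

/-- **The Θ-pin is CORIC along the étale transport MODULO the cross-column Kummer identification**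
`hfrob : starAut Φ '' (S.col P.n).frobΨ m = (S.col n').frobΨ m` — the identification of copies
between the columns' Kummer images (Thm. 3.11 (ii)'s log-Kummer content across columns). With it,
the recolumned setting is `ThetaPinned` by the SAME `ρ` on its OWN column's data; without it, only
the covariant form (transported datum) holds, as in §1. The frozen vocabulary supplies no `hfrob`;
its explicit appearance here is the isolation, not a defect. [folklore] -/
theorem thetaPinned_recolumn_of_frobCompat
    (hΦ : Φ ∈ Subgroup.closure (S.L.Ind1Family ∪ S.L.Ind2Family))
    (hΘ : ThetaPinned S P ρ)
    (hfrob : ∀ (m : ℤ) (v : T.V) (hv : v ∈ T.Vbad),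
      S.L.starAut Φ v '' (S.col P.n).frobΨ m v hv = (S.col n').frobΨ m v hv) :
    ThetaPinned S (P.recolumn n' Φ hD) ρ := by
  refine ⟨hΘ.1, fun m j vQ => ?_⟩
  have hdat : (fun v hv => S.L.starAut Φ v '' (S.col P.n).frobΨ m v hv) =
      (S.col n').frobΨ m := by
    funext v
    funext hv
    exact hfrob m v hv
  show (P.recolumn n' Φ hD).thetaRegion m j vQ = ρ ((S.col n').frobΨ m) j vQ
  rw [P.recolumn_thetaRegion n' Φ hD m j vQ, hΘ.2 m j vQ,
    ← hΘ.1 Φ hΦ ((S.col P.n).frobΨ m) j vQ, hdat]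

/-- **The q-pin transports covariantly along the étale transport with NO condition**: the recolumned
q-region is `ρ` of the `starAut Φ`-moved q-datum — the uninterpreted `qK` simply moves with the
glue. [folklore] -/
theorem qPinned_recolumn_map
    (hΦ : Φ ∈ Subgroup.closure (S.L.Ind1Family ∪ S.L.Ind2Family))
    (hρ : ∀ Φ' ∈ Subgroup.closure (S.L.Ind1Family ∪ S.L.Ind2Family),
      ∀ (Ψ : ∀ v : T.V, v ∈ T.Vbad → Set (S.L.StarPacket v)) (j : T.Label) (vQ : T.VQ),
        ρ (fun v hv => S.L.starAut Φ' v '' Ψ v hv) j vQ = Φ' j vQ '' ρ Ψ j vQ)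
    (hq : QPinned S P ρ qK) :
    QPinned S (P.recolumn n' Φ hD) ρ (fun v hv => S.L.starAut Φ v '' qK v hv) := by
  intro j vQ
  show (P.recolumn n' Φ hD).qRegion j vQ = ρ (fun v hv => S.L.starAut Φ v '' qK v hv) j vQ
  rw [P.recolumn_qRegion n' Φ hD j vQ, hq j vQ, ← hρ Φ hΦ qK j vQ]

/-- **`PinnedRegions` along the étale transport**: the pair transports — the Θ-pin re-lands on the
new column's own Kummer data modulo `hfrob`, the q-datum moves covariantly free. The étale coricity
of PR-1's reading consumes EXACTLY the cross-column identification `hfrob`, and nothing else beyond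
the reading's own (hρ). [folklore] -/
theorem pinnedRegions_recolumn_of_frobCompat
    (hΦ : Φ ∈ Subgroup.closure (S.L.Ind1Family ∪ S.L.Ind2Family))
    (hpin : PinnedRegions S P ρ qK)
    (hfrob : ∀ (m : ℤ) (v : T.V) (hv : v ∈ T.Vbad),
      S.L.starAut Φ v '' (S.col P.n).frobΨ m v hv = (S.col n').frobΨ m v hv) :
    PinnedRegions S (P.recolumn n' Φ hD) ρ (fun v hv => S.L.starAut Φ v '' qK v hv) :=
  ⟨thetaPinned_recolumn_of_frobCompat S P ρ n' Φ hD hΦ hpin.1 hfrob,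
    qPinned_recolumn_map S P ρ qK n' Φ hD hΦ hpin.1.1 hpin.2⟩

end Recolumn

/-! ## 4. The q-glue twist: mirror of §1 for the q-pin -/

section QTwist
variable (Φ₀ : S.toSituation.L.PacketAut)
  (hmem : ∀ (j : T.Label) (vQ : T.VQ),
    Φ₀ j vQ '' P.qRegionOf (qPilotObject P.qData) j vQ ∈ (P.frame j vQ).Hul)
  (hfin : ∀ j : T.Label, (Function.support fun vQ =>
    (S.toSituation.D P.n).logvol j vQ (Φ₀ j vQ '' P.qRegionOf (qPilotObject P.qData) j vQ)).Finite)

/-- The q-twisted setting is q-pinned (by the same `ρ`) to the `starAut Φ₀`-moved q-datum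
(covariant form, via (hρ)). [folklore] -/
theorem qPinned_qTwistGlue_map
    (hΦ₀ : Φ₀ ∈ Subgroup.closure (S.L.Ind1Family ∪ S.L.Ind2Family))
    (hρ : ∀ Φ' ∈ Subgroup.closure (S.L.Ind1Family ∪ S.L.Ind2Family),
      ∀ (Ψ : ∀ v : T.V, v ∈ T.Vbad → Set (S.L.StarPacket v)) (j : T.Label) (vQ : T.VQ),
        ρ (fun v hv => S.L.starAut Φ' v '' Ψ v hv) j vQ = Φ' j vQ '' ρ Ψ j vQ)
    (hq : QPinned S P ρ qK) :
    QPinned S (P.qTwistGlue Φ₀ hmem hfin) ρ (fun v hv => S.L.starAut Φ₀ v '' qK v hv) := by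
  intro j vQ
  show (P.qTwistGlue Φ₀ hmem hfin).qRegion j vQ =
    ρ (fun v hv => S.L.starAut Φ₀ v '' qK v hv) j vQ
  rw [P.qTwistGlue_qRegion Φ₀ hmem hfin j vQ, hq j vQ, ← hρ Φ₀ hΦ₀ qK j vQ]

/-- **The NAIVE q-pin does not survive a bare q-glue twist**: given `QPinned` at `P` and (hρ), the
q-twisted setting is pinned to the UNTRANSPORTED `qK` iff the `ρ`-output at `qK` is fixed by the
twist — mirror of `thetaPinned_twistGlue_iff_fixed`; the reading pins the q-glue to its datum beyond
the declared indeterminacy. [folklore] -/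
theorem qPinned_qTwistGlue_iff_fixed
    (hΦ₀ : Φ₀ ∈ Subgroup.closure (S.L.Ind1Family ∪ S.L.Ind2Family))
    (hρ : ∀ Φ' ∈ Subgroup.closure (S.L.Ind1Family ∪ S.L.Ind2Family),
      ∀ (Ψ : ∀ v : T.V, v ∈ T.Vbad → Set (S.L.StarPacket v)) (j : T.Label) (vQ : T.VQ),
        ρ (fun v hv => S.L.starAut Φ' v '' Ψ v hv) j vQ = Φ' j vQ '' ρ Ψ j vQ)
    (hq : QPinned S P ρ qK) :
    QPinned S (P.qTwistGlue Φ₀ hmem hfin) ρ qK ↔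
      ∀ (j : T.Label) (vQ : T.VQ),
        ρ (fun v hv => S.L.starAut Φ₀ v '' qK v hv) j vQ = ρ qK j vQ := by
  unfold QPinned
  refine forall_congr' fun j => forall_congr' fun vQ => ?_
  rw [qPinned_qTwistGlue_map S P ρ qK Φ₀ hmem hfin hΦ₀ hρ hq j vQ]

/-- The Θ-pin ignores the q-glue twist (the Θ-side never reads the q-glue). [folklore] -/
theorem thetaPinned_qTwistGlue_iff :
    ThetaPinned S (P.qTwistGlue Φ₀ hmem hfin) ρ ↔ ThetaPinned S P ρ :=
  Iff.rfl

end QTwist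

end Summit.ABC.IUTFork.Cor312Vol

end
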